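import Literature.MathematicalPhysics.QuantumLattice.HubbardTTPrimeGrandCanonicalGibbsSymmetries
import HarnessLib

/-!
# Symmetries of the thermal grand-canonical states of the 2D `t–t'` Hubbard model: `D₄`-invariance, spin flip
# `h ↦ −h`, particle–hole `(t', μ, h) ↦ (−t', U − μ, −h)`; zero-field and half-filling identities

Topic `Literature/MathematicalPhysics/QuantumLattice`; torus-limit half of `HubbardTTPrimeGrandCanonicalGibbsSymmetries.lean`,
for the class of THERMAL GRAND-CANONICAL STATES of `HubbardTTPrimeGrandCanonicalThermalStates*.lean`: torus limits `ω` of the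
Gibbs states `e^{−βK_L}/Ξ_L`, `K_L = H_L − μN − hM`, i.e.
`ω.IsTorusLimitOfMixture sourcedGibbsCount (gcGibbsWeightTT' β t t' U μ h) (gcGibbsVectorTT' t t' U μ h) Ls`, `Ls → ∞`
(any real `β, t, t', U, μ, h`). PROVED:

* **every thermal grand-canonical state is `D₄`-invariant** (`isD4Invariant_of_gcGibbs`) and kills every affine-`D₄` defect
  of a window certificate (`expect_d4Defect_eq_zero_of_gcGibbs`) — point-group-reduced T > 0 certificates are read in the
  grand-canonical class without orbit averaging (translation invariance is `IsTorusLimitOfMixture.isTranslationInvariant`,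
  evenness `…isEven_of_gcGibbs`);
* **its spin flip `ω ∘ Γ_swap` is a thermal grand-canonical state at `−h` along the same sides** (`spinFlip_of_gcGibbs`;
  `forall_spinFlip_of_gcGibbs`: every word for the class at `−h` reads on `ω ∘ Γ_swap`); hence **at `h = 0` every thermal
  grand-canonical state is spin-flip invariant** (`spinFlip_eq_of_gcGibbs`, `expect_relabel_spinSwap_sub_eq_zero_of_gcGibbs`)
  with `ω(n_{x↑}) = ω(n_{x↓})` at every site and `Re ω(n_{0σ}) = ρ(ω)/2` (`expect_nAt_up_eq_down_of_gcGibbs`,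
  `spinUp_eq_spinDown_of_gcGibbs`, `spinUp_eq_half_density_of_gcGibbs`, `spinDown_eq_half_density_of_gcGibbs`) — ZERO
  MAGNETISATION DENSITY for every thermal grand-canonical state at zero field, every temperature (an exact identity the
  `h = 0` relaxation may impose, sharper than the logistic windows of `…ThermalStatesSpinDensities`);
* **its particle–hole transform `ω ∘ α` is a thermal grand-canonical state at `(t,−t',U,U−μ,−h)`** along eventually-even sides
  (`particleHole_of_gcGibbs`, `forall_particleHole_of_gcGibbs`), with `ρ(ω ∘ α) = 2 − ρ(ω)`; at the SELF-DUAL point `t' = 0`,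
  `μ = U/2`, `h = 0`: **`ω ∘ α = ω` and `ρ(ω) = 1`, `Re ω(n_{0σ}) = 1/2` for EVERY thermal grand-canonical state**
  (`particleHole_eq_of_gcGibbs`, `density_eq_one_of_gcGibbs_halfFilling`, `spinUp_eq_half_of_gcGibbs_halfFilling`) — the
  torus-limit form of the uniform density theorem at half filling, every real `β, t, U`.

Everything is PROVED; no definition, no named fact, no instance.

## Mathlib / tree search

REUSED: `sum_gcGibbsWeightTT'_mul_torusAvgExpectAt_d4Emb / _relabel_spinSwap / _phAut` (`HubbardTTPrimeGrandCanonicalGibbsSymmetries`);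
`d4Act_expect`, `IsTranslationInvariant.expect_d4Defect_eq_zero` (`InfVolFermionStatePointGroupAction`); `spinFlip_expect`,
`spinFlip_expect_nAt` (`InfVolFermionStateSpinFlip`); `particleHole_expect`, `density_particleHole` (`InfVolFermionStateParticleHole`);
`IsTorusLimitOfMixture.isTranslationInvariant`, `torusAvgExpect_eq`, `eventually_injOn_proj_of_tendsto` (`TorusLimitOfMixtures`,
`InfVolFermionState`); `densityAt`, `density`. Pattern: `IsTorusLimitOfMixture.isD4Invariant_of_sectorGibbs`,
`…spinFlip_eq_of_sectorGibbs`, `…particleHole_of_sectorGibbs` (canonical sector). `lean search 'of_gcGibbs.*(D4|spinFlip|particleHole)'`: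
nothing (2026-08-27).

## References

* O. Bratteli, D. W. Robinson, *OAQSM 2* (1997), §5.3.1 (symmetries of Gibbs/KMS states). [cite: BratteliRobinsonII1997, §5.3.1]
* E. H. Lieb, M. Loss, R. J. McCann, J. Math. Phys. 34 (1993) 891, Theorem (uniform density `ρ = 1/2` per spin at half filling,
  grand-canonical and canonical, every `β`). [cite: LiebLossMccann1993, Theorem]
* X. Han, arXiv:2006.06002 (2020), §3 (symmetry constraints in bootstrap relaxations). [cite: Han2020Bootstrap, §3]
* R. B. Israel, *Convexity in the Theory of Lattice Gases* (1979), §I.3 eq. (26). [cite: Israel1979, §I.3 eq. (26)]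
-/

noncomputable section

namespace Literature.MathematicalPhysics.QuantumLattice

open Matrix Finset HubbardWave0 Literature.Probability.LatticeModels ThermodynamicLimit
open _root_.Filter
open scoped _root_.Topology ComplexOrder BigOperators

/-! ### §3 Torus limits: symmetries of thermal grand-canonical states -/

namespace InfVolFermionState

variable {β t t' U μ hz : ℝ} {ω : InfVolFermionState 2} {Ls : ℕ → ℕ}

/-- **Thermal grand-canonical states are point-group invariant** (every real `β, t, t', U, μ, h`): `ω ∘ γ = ω` for
every `γ ∈ D₄`. [cite: Han2020Bootstrap, §3] -/
theorem IsTorusLimitOfMixture.isD4Invariant_of_gcGibbs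
    (hω : ω.IsTorusLimitOfMixture sourcedGibbsCount (gcGibbsWeightTT' β t t' U μ hz) (gcGibbsVectorTT' t t' U μ hz) Ls)
    (hLs : Tendsto Ls atTop atTop) : ω.IsD4Invariant := by
  intro γ
  refine InfVolFermionState.ext fun Λ => LinearMap.ext fun A => ?_
  rw [d4Act_expect]
  refine tendsto_nhds_unique (hω (d4ShiftSet γ 0 Λ) (fermionEmbed (PolySite.d4Emb γ 0 Λ) A)) ((hω Λ A).congr' ?_)
  filter_upwards [eventually_injOn_proj_of_tendsto Λ hLs, eventually_injOn_proj_of_tendsto (d4ShiftSet γ 0 Λ) hLs,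
    hLs.eventually_ge_atTop 1] with j h1 h2 hj
  haveI : NeZero (Ls j) := ⟨by omega⟩
  simp_rw [torusAvgExpect_eq]
  exact (sum_gcGibbsWeightTT'_mul_torusAvgExpectAt_d4Emb (Ls j) β t t' U μ hz γ h1 h2 A).symm

/-- **Thermal grand-canonical states kill every affine-`D₄` defect of a window certificate**:
`ω_{Λ'}(Γ(incl)(Γ(d4Emb γ w Λ) Y) − Γ(incl) Y) = 0` (`Λ ⊆ Λ'`, `γΛ + w ⊆ Λ'`). [cite: Han2020Bootstrap, §3] -/
theorem IsTorusLimitOfMixture.expect_d4Defect_eq_zero_of_gcGibbs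
    (hω : ω.IsTorusLimitOfMixture sourcedGibbsCount (gcGibbsWeightTT' β t t' U μ hz) (gcGibbsVectorTT' t t' U μ hz) Ls)
    (hLs : Tendsto Ls atTop atTop) {Λ Λ' : Finset (Site 2)} (hΛ : Λ ⊆ Λ') (γ : DihedralGroup 4) (w : Site 2)
    (hsh : d4ShiftSet γ w Λ ⊆ Λ') (Y : FermionOp Λ) :
    ω.expect Λ' (fermionEmbed (PolySite.incl hsh) (fermionEmbed (PolySite.d4Emb γ w Λ) Y) -
      fermionEmbed (PolySite.incl hΛ) Y) = 0 :=
  hω.isTranslationInvariant.expect_d4Defect_eq_zero (hω.isD4Invariant_of_gcGibbs hLs) hΛ γ w hsh Y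

/-- **The spin flip of a thermal grand-canonical state at field `h` is a thermal grand-canonical state at `−h`**,
along the same sides. [cite: BratteliRobinsonII1997, §5.3.1] -/
theorem IsTorusLimitOfMixture.spinFlip_of_gcGibbs
    (hω : ω.IsTorusLimitOfMixture sourcedGibbsCount (gcGibbsWeightTT' β t t' U μ hz) (gcGibbsVectorTT' t t' U μ hz) Ls)
    (hLs : Tendsto Ls atTop atTop) :
    ω.spinFlip.IsTorusLimitOfMixture sourcedGibbsCount (gcGibbsWeightTT' β t t' U μ (-hz))
      (gcGibbsVectorTT' t t' U μ (-hz)) Ls := by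
  intro Λ A
  rw [spinFlip_expect]
  refine (hω Λ _).congr' ?_
  filter_upwards [eventually_injOn_proj_of_tendsto Λ hLs, hLs.eventually_ge_atTop 1] with j h1 hj
  haveI : NeZero (Ls j) := ⟨by omega⟩
  simp_rw [torusAvgExpect_eq]
  exact sum_gcGibbsWeightTT'_mul_torusAvgExpectAt_relabel_spinSwap (Ls j) β t t' U μ hz h1 A

/-- **At zero field every thermal grand-canonical state is spin-flip invariant**: `ω ∘ Γ_swap = ω` (`h = 0`; every
real `β, t, t', U, μ`). [cite: BratteliRobinsonII1997, §5.3.1] -/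
theorem IsTorusLimitOfMixture.spinFlip_eq_of_gcGibbs
    (hω : ω.IsTorusLimitOfMixture sourcedGibbsCount (gcGibbsWeightTT' β t t' U μ 0) (gcGibbsVectorTT' t t' U μ 0) Ls)
    (hLs : Tendsto Ls atTop atTop) : ω.spinFlip = ω := by
  have h := hω.spinFlip_of_gcGibbs hLs
  rw [neg_zero] at h
  exact InfVolFermionState.ext fun Λ => LinearMap.ext fun A => tendsto_nhds_unique (h Λ A) (hω Λ A)

/-- **Zero-field thermal grand-canonical states kill the spin-flip defects of a window certificate**:
`ω_{Λ'}(Γ_swap Y − Y) = 0`. [cite: Han2020Bootstrap, §3] -/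
theorem IsTorusLimitOfMixture.expect_relabel_spinSwap_sub_eq_zero_of_gcGibbs
    (hω : ω.IsTorusLimitOfMixture sourcedGibbsCount (gcGibbsWeightTT' β t t' U μ 0) (gcGibbsVectorTT' t t' U μ 0) Ls)
    (hLs : Tendsto Ls atTop atTop) {Λ' : Finset (Site 2)} (Y : FermionOp Λ') :
    ω.expect Λ' (relabel (Orb.spinSwap : Orb (PolySite Λ') ≃ Orb (PolySite Λ')) Y - Y) = 0 := by
  rw [map_sub, ← spinFlip_expect, hω.spinFlip_eq_of_gcGibbs hLs, sub_self]

/-- **Zero magnetisation at zero field**: `Re ω(n_{0↑}) = Re ω(n_{0↓})` for every thermal grand-canonical state at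
`h = 0` (any `β, t, t', U, μ`); in fact `ω(n_{x↑}) = ω(n_{x↓})` at every site. [cite: BratteliRobinsonII1997, §5.3.1] -/
theorem IsTorusLimitOfMixture.expect_nAt_up_eq_down_of_gcGibbs
    (hω : ω.IsTorusLimitOfMixture sourcedGibbsCount (gcGibbsWeightTT' β t t' U μ 0) (gcGibbsVectorTT' t t' U μ 0) Ls)
    (hLs : Tendsto Ls atTop atTop) {Λ : Finset (Site 2)} (x : Site 2) (hx : x ∈ Λ) :
    ω.expect Λ (nAt x hx 0) = ω.expect Λ (nAt x hx 1) := by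
  have h := hω.spinFlip_eq_of_gcGibbs hLs
  have h1 := spinFlip_expect_nAt (ω := ω) x hx 0
  rw [h] at h1
  rw [h1]
  simp only [Equiv.swap_apply_left]

/-- `Re ω(n_{0↑}) = Re ω(n_{0↓})` (the form the spin-density files use). [cite: BratteliRobinsonII1997, §5.3.1] -/
theorem IsTorusLimitOfMixture.spinUp_eq_spinDown_of_gcGibbs
    (hω : ω.IsTorusLimitOfMixture sourcedGibbsCount (gcGibbsWeightTT' β t t' U μ 0) (gcGibbsVectorTT' t t' U μ 0) Ls)
    (hLs : Tendsto Ls atTop atTop) :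
    (ω.expect ({0} : Finset (Site 2)) (nAt 0 (Finset.mem_singleton_self 0) 0)).re =
      (ω.expect ({0} : Finset (Site 2)) (nAt 0 (Finset.mem_singleton_self 0) 1)).re := by
  rw [hω.expect_nAt_up_eq_down_of_gcGibbs hLs]

/-- **Each spin density is half the density at zero field**: `Re ω(n_{0↑}) = ρ(ω)/2` (and the same for `↓`).
[cite: BratteliRobinsonII1997, §5.3.1] -/
theorem IsTorusLimitOfMixture.spinUp_eq_half_density_of_gcGibbs
    (hω : ω.IsTorusLimitOfMixture sourcedGibbsCount (gcGibbsWeightTT' β t t' U μ 0) (gcGibbsVectorTT' t t' U μ 0) Ls)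
    (hLs : Tendsto Ls atTop atTop) :
    (ω.expect ({0} : Finset (Site 2)) (nAt 0 (Finset.mem_singleton_self 0) 0)).re = ω.density / 2 := by
  have h := hω.spinUp_eq_spinDown_of_gcGibbs hLs
  rw [density, densityAt, map_add, Complex.add_re, ← h]
  ring

/-- `Re ω(n_{0↓}) = ρ(ω)/2` at zero field. [cite: BratteliRobinsonII1997, §5.3.1] -/
theorem IsTorusLimitOfMixture.spinDown_eq_half_density_of_gcGibbs
    (hω : ω.IsTorusLimitOfMixture sourcedGibbsCount (gcGibbsWeightTT' β t t' U μ 0) (gcGibbsVectorTT' t t' U μ 0) Ls)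
    (hLs : Tendsto Ls atTop atTop) :
    (ω.expect ({0} : Finset (Site 2)) (nAt 0 (Finset.mem_singleton_self 0) 1)).re = ω.density / 2 := by
  rw [← hω.spinUp_eq_spinDown_of_gcGibbs hLs, hω.spinUp_eq_half_density_of_gcGibbs hLs]

/-- **The particle–hole transform of a thermal grand-canonical state at `(t,t',U,μ,h)` is a thermal grand-canonical
state at `(t,−t',U,U−μ,−h)`**, along the same (eventually even) sides. [cite: LiebLossMccann1993, Theorem] -/
theorem IsTorusLimitOfMixture.particleHole_of_gcGibbs
    (hω : ω.IsTorusLimitOfMixture sourcedGibbsCount (gcGibbsWeightTT' β t t' U μ hz) (gcGibbsVectorTT' t t' U μ hz) Ls)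
    (hLs : Tendsto Ls atTop atTop) (heven : ∀ᶠ j in atTop, Even (Ls j)) :
    ω.particleHole.IsTorusLimitOfMixture sourcedGibbsCount (gcGibbsWeightTT' β t (-t') U (U - μ) (-hz))
      (gcGibbsVectorTT' t (-t') U (U - μ) (-hz)) Ls := by
  intro Λ A
  rw [particleHole_expect]
  refine (hω Λ (phAut Λ A)).congr' ?_
  filter_upwards [eventually_injOn_proj_of_tendsto Λ hLs, hLs.eventually_ge_atTop 1, heven] with j h1 hj hev
  haveI : NeZero (Ls j) := ⟨by omega⟩
  simp_rw [torusAvgExpect_eq]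
  exact sum_gcGibbsWeightTT'_mul_torusAvgExpectAt_phAut (Ls j) β t t' U μ hz hev h1 A

/-- **Densities of a particle–hole pair of thermal grand-canonical states add up to `2`**: with `ω` at `(t,t',U,μ,h)`
and `ω ∘ α` at `(t,−t',U,U−μ,−h)`, `ρ(ω ∘ α) = 2 − ρ(ω)`. [cite: LiebLossMccann1993, Theorem] -/
theorem density_particleHole_eq_two_sub (ω : InfVolFermionState 2) : ω.particleHole.density = 2 - ω.density :=
  density_particleHole ω

/-- **Self-duality at `t' = 0`, `μ = U/2`, `h = 0`**: there every thermal grand-canonical state (along eventually even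
sides) is particle–hole invariant, `ω ∘ α = ω`. [cite: LiebLossMccann1993, Theorem] -/
theorem IsTorusLimitOfMixture.particleHole_eq_of_gcGibbs
    (hω : ω.IsTorusLimitOfMixture sourcedGibbsCount (gcGibbsWeightTT' β t 0 U (U / 2) 0) (gcGibbsVectorTT' t 0 U (U / 2) 0) Ls)
    (hLs : Tendsto Ls atTop atTop) (heven : ∀ᶠ j in atTop, Even (Ls j)) : ω.particleHole = ω := by
  have h := hω.particleHole_of_gcGibbs hLs heven
  rw [neg_zero, show U - U / 2 = U / 2 by ring] at h
  exact InfVolFermionState.ext fun Λ => LinearMap.ext fun A => tendsto_nhds_unique (h Λ A) (hω Λ A)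

/-- **Uniform density at half filling, torus-limit form**: every thermal grand-canonical state of the
nearest-neighbour Hubbard model at `μ = U/2`, `h = 0` (along eventually even sides; any real `β, t, U`) has density
EXACTLY `1`. [cite: LiebLossMccann1993, Theorem] -/
theorem IsTorusLimitOfMixture.density_eq_one_of_gcGibbs_halfFilling
    (hω : ω.IsTorusLimitOfMixture sourcedGibbsCount (gcGibbsWeightTT' β t 0 U (U / 2) 0) (gcGibbsVectorTT' t 0 U (U / 2) 0) Ls)
    (hLs : Tendsto Ls atTop atTop) (heven : ∀ᶠ j in atTop, Even (Ls j)) : ω.density = 1 := by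
  have h1 := density_particleHole ω
  rw [hω.particleHole_eq_of_gcGibbs hLs heven] at h1
  linarith

/-- … and spin densities exactly `1/2` each. [cite: LiebLossMccann1993, Theorem] -/
theorem IsTorusLimitOfMixture.spinUp_eq_half_of_gcGibbs_halfFilling
    (hω : ω.IsTorusLimitOfMixture sourcedGibbsCount (gcGibbsWeightTT' β t 0 U (U / 2) 0) (gcGibbsVectorTT' t 0 U (U / 2) 0) Ls)
    (hLs : Tendsto Ls atTop atTop) (heven : ∀ᶠ j in atTop, Even (Ls j)) :
    (ω.expect ({0} : Finset (Site 2)) (nAt 0 (Finset.mem_singleton_self 0) 0)).re = 1 / 2 := by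
  rw [hω.spinUp_eq_half_density_of_gcGibbs hLs, hω.density_eq_one_of_gcGibbs_halfFilling hLs heven]

/-- **Every word for the reflected class is a word for `ω ∘ α`**: if a property `P` holds for every thermal
grand-canonical state at `(t,−t',U,U−μ,−h)` along every divergent side sequence, then `P (ω ∘ α)` for every thermal
grand-canonical state `ω` at `(t,t',U,μ,h)` along eventually-even `Ls → ∞`. [cite: LiebLossMccann1993, Theorem] -/
theorem IsTorusLimitOfMixture.forall_particleHole_of_gcGibbs {P : InfVolFermionState 2 → Prop}
    (hP : ∀ (Ls' : ℕ → ℕ) (ω' : InfVolFermionState 2), Tendsto Ls' atTop atTop →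
      ω'.IsTorusLimitOfMixture sourcedGibbsCount (gcGibbsWeightTT' β t (-t') U (U - μ) (-hz))
        (gcGibbsVectorTT' t (-t') U (U - μ) (-hz)) Ls' → P ω')
    (hω : ω.IsTorusLimitOfMixture sourcedGibbsCount (gcGibbsWeightTT' β t t' U μ hz) (gcGibbsVectorTT' t t' U μ hz) Ls)
    (hLs : Tendsto Ls atTop atTop) (heven : ∀ᶠ j in atTop, Even (Ls j)) : P ω.particleHole :=
  hP Ls _ hLs (hω.particleHole_of_gcGibbs hLs heven)

/-- **Every word for the class at `−h` is a word for `ω ∘ Γ_swap`.** [cite: BratteliRobinsonII1997, §5.3.1] -/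
theorem IsTorusLimitOfMixture.forall_spinFlip_of_gcGibbs {P : InfVolFermionState 2 → Prop}
    (hP : ∀ (Ls' : ℕ → ℕ) (ω' : InfVolFermionState 2), Tendsto Ls' atTop atTop →
      ω'.IsTorusLimitOfMixture sourcedGibbsCount (gcGibbsWeightTT' β t t' U μ (-hz))
        (gcGibbsVectorTT' t t' U μ (-hz)) Ls' → P ω')
    (hω : ω.IsTorusLimitOfMixture sourcedGibbsCount (gcGibbsWeightTT' β t t' U μ hz) (gcGibbsVectorTT' t t' U μ hz) Ls)
    (hLs : Tendsto Ls atTop atTop) : P ω.spinFlip :=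
  hP Ls _ hLs (hω.spinFlip_of_gcGibbs hLs)

end InfVolFermionState

end Literature.MathematicalPhysics.QuantumLattice

end
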